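import Mathlib
import HarnessLib
import Summits.NavierStokesRegularity.NavierStokesRegularity.Theorems.TaylorModelRungThreeCertificateFormatVInterpLemmas
import Summits.NavierStokesRegularity.NavierStokesRegularity.Theorems.TaylorModelRungThreeCertificateFormatVInterpW
import Summits.NavierStokesRegularity.NavierStokesRegularity.Theorems.TaylorModelRungThreeCertificateCoreStepDefs

/-!
# Crux K1b-DR (stmt-NavierStokesRegularity-23954), line `taylor-model` — v3 certificate SOUNDNESS, radii side:
# `ChainVRadii (toCertDataVW …) (toBoxesW …) (toRadiiW …)` from the checker's Booleans (successor engine-1 g67;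
# PROPAGATE-V-SPEC-cert1 rev. bcee1edc560e3a8a §2 E; `TaylorModelV.ChainVRadii` p623604)

From `ChecksOK` (entry node frame test, `rB ≥ 0`, every sub-step's `subStep … ok` — what the generated chunk theorems give
through `checkRange_sound`), `EntryOK` (the Farkas clause, separate file) and `TwinOK` (field twin, from `CoefOK`/`CoefBoxOK`
in the closer), this file proves every clause of `ChainVRadii` for the interpreted records: stage clauses by construction of
the entry node; node clauses (`e ≥ 0`, HINGE `y ∈ x ± (|Vc|rB + e + |B|rp)`); (R3) from `nu_sound` + the centre-polynomial
enclosure; (R2)/(R4)/(R5) from `stepNext_sound` through `kapp_eq_linF`, `memMat_matOfKer`, `invMat_spec_of_nodeOK` and the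
range-matrix algebra `B'·(Ci'·D + (Ci'·a·B)·w) = D + (a·B)·w` on the block.
MODEL-lattice bookkeeping only (rung TL-M3); nothing here is a statement about the Navier–Stokes equations.
-/

-- the sub-problem namespace repeats the summit name by design (D-0017)
set_option linter.dupNamespace false

namespace Summit.NavierStokesRegularity.NavierStokesRegularity.Theorems.TaylorModelCert

open scoped BigOperators
open Literature.Analysis.FluidPDE.TaoCascade Literature.Analysis.FluidPDE.TaoCascade.TaylorChain
open Summit.NavierStokesRegularity.NavierStokesRegularity.Theorems.TaylorModelReadout
open Summit.NavierStokesRegularity.NavierStokesRegularity.Theorems.TaylorModelV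

namespace CertTablesV

variable (TV : CertTablesV) (kitOf : ℕ → CoreKit) (wT : ℕ → Array Dyad) (sc : ScalarsV)

/-- The Boolean facts the radii soundness consumes. [folklore] -/
structure ChecksOK : Prop where
  /-- the entry node of every stage passes the frame test -/
  node0 : ∀ j, j ≤ TV.base.N₀ → nodeOK TV.base.n TV.prec (TV.ctxOfW kitOf wT j).N0 = true
  /-- the stage box radii are nonnegative -/
  rB : ∀ j, j ≤ TV.base.N₀ → nonnegVec TV.base.n (TV.stageV j).rB = true
  /-- every sub-step passes (from the chunk theorems via `checkRange_sound`) -/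
  steps : ∀ j, j ≤ TV.base.N₀ → ∀ s, s < TV.S j →
    ((TV.ctxOfW kitOf wT j).subStep s ((TV.ctxOfW kitOf wT j).nodeAt s)).ok = true

/-- The ENTRY clause (discharged by the Farkas checker of the entry file). [folklore] -/
def EntryOK (TV : CertTablesV) (kitOf : ℕ → CoreKit) (wT : ℕ → Array Dyad) (sc : ScalarsV) : Prop :=
  ∀ j, j ≤ TV.base.N₀ → ∀ q : Fin 4 → ℤ → ℝ, InPoly (TV.toCertDataVW kitOf wT sc) j q →
    ∃ ζ : Fin 4 → ℤ → ℝ, AbsLeW (TV.toCertDataVW kitOf wT sc) ζ ((TV.toRadiiW kitOf wT).rB j) ∧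
      ∀ i k, -TV.base.Kb ≤ k → k ≤ TV.base.Ka → q i k = (TV.xR j 0 + (TV.toRadiiW kitOf wT).Dsc j ζ) i k

/-- The field-twin hypothesis (from `CoefOK`, `CoefBoxOK`, `(kitOf j).mt = monosTable`; supplied by the closer). [folklore] -/
def TwinOK (TV : CertTablesV) (kitOf : ℕ → CoreKit) : Prop :=
  ∀ j : ℕ, IntervalD.IsFieldEnclosureA TV.base.wv (qBf (TV.base.toCertData QS2.toRealHom)) TV.base.n
    (TV.base.qBboxMA (kitOf j).coefB TV.prec (kitOf j).mt)

variable {TV kitOf wT sc}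

/-! ### Field reductions (all definitional) -/

section Rfl

/-- [folklore] -/ theorem cd_Kb : (TV.toCertDataVW kitOf wT sc).Kb = TV.base.Kb := rfl
/-- [folklore] -/ theorem cd_Ka : (TV.toCertDataVW kitOf wT sc).Ka = TV.base.Ka := rfl
/-- [folklore] -/ theorem cd_N₀ : (TV.toCertDataVW kitOf wT sc).N₀ = TV.base.N₀ := rfl
/-- [folklore] -/ theorem cd_S (j : ℕ) : (TV.toCertDataVW kitOf wT sc).S j = TV.S j := rfl
/-- [folklore] -/ theorem cd_pdeg : (TV.toCertDataVW kitOf wT sc).pdeg = TV.base.pdeg := rfl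
/-- [folklore] -/ theorem cd_h (j s : ℕ) : (TV.toCertDataVW kitOf wT sc).h j s = TV.hR j s := rfl
/-- [folklore] -/ theorem cd_x (j s : ℕ) : (TV.toCertDataVW kitOf wT sc).x j s = TV.xR j s := rfl
/-- [folklore] -/
theorem cd_Cm (j s : ℕ) : (TV.toCertDataVW kitOf wT sc).Cm j s = TV.base.linF (dre (TV.nodeVW kitOf wT j s).B) := rfl
/-- [folklore] -/
theorem cd_Ci (j s : ℕ) : (TV.toCertDataVW kitOf wT sc).Ci j s = TV.base.linF (invMat TV.base.n (TV.nodeVW kitOf wT j s).B) := rfl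
/-- [folklore] -/
theorem cd_TP (j s : ℕ) (u : ℝ) (i : Fin 4) (k : ℤ) : (TV.toCertDataVW kitOf wT sc).TP j s u i k =
    ∑ m ∈ Finset.range (TV.base.pdeg + 1), taylorJet (TV.base.toCertData QS2.toRealHom).Qb (TV.xR j s) m i k * u ^ m := rfl
/-- [folklore] -/
theorem bx_rPl (l : Fin 3) (j s : ℕ) : (TV.toBoxesW kitOf wT).rPl l j s = TV.base.vecF (vre (TV.nodeVW kitOf wT j s).rp) := rfl
/-- [folklore] -/ theorem bx_J (j s : ℕ) : (TV.toBoxesW kitOf wT).J j s = TV.base.vecF (vre (TV.coreVW kitOf wT j s).J) := rfl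
/-- [folklore] -/ theorem bx_Mlo (j s : ℕ) : (TV.toBoxesW kitOf wT).Mlo j s = TV.base.kerLo (TV.coreVW kitOf wT j s).M := rfl
/-- [folklore] -/ theorem bx_Mhi (j s : ℕ) : (TV.toBoxesW kitOf wT).Mhi j s = TV.base.kerHi (TV.coreVW kitOf wT j s).M := rfl
/-- [folklore] -/
theorem bx_hlo1 (j s : ℕ) : (TV.toBoxesW kitOf wT).hlo 1 j s =
    TV.base.vecF (loOf (TV.xD j s) ((TV.ctxOfW kitOf wT j).hullRad (TV.nodeVW kitOf wT j s))) := rfl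
/-- [folklore] -/
theorem bx_hhi1 (j s : ℕ) : (TV.toBoxesW kitOf wT).hhi 1 j s =
    TV.base.vecF (hiOf (TV.xD j s) ((TV.ctxOfW kitOf wT j).hullRad (TV.nodeVW kitOf wT j s))) := rfl
/-- [folklore] -/ theorem rd_rB (j : ℕ) : (TV.toRadiiW kitOf wT).rB j = TV.base.vecF (vre (TV.stageV j).rB) := rfl
/-- [folklore] -/
theorem rd_Dsc (j : ℕ) : (TV.toRadiiW kitOf wT).Dsc j = TV.base.linF (dre (diagD TV.base.n (TV.stageV j).D)) := rfl
/-- [folklore] -/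
theorem rd_Vc (j s : ℕ) : (TV.toRadiiW kitOf wT).Vc j s = TV.base.linF (dre (TV.nodeVW kitOf wT j s).Vc) := rfl
/-- [folklore] -/ theorem rd_e (j s : ℕ) : (TV.toRadiiW kitOf wT).e j s = TV.base.vecF (vre (TV.nodeVW kitOf wT j s).e) := rfl
/-- [folklore] -/
theorem rd_ν (j s : ℕ) : (TV.toRadiiW kitOf wT).ν j s = TV.base.vecF (vre ((TV.ctxOfW kitOf wT j).nuOf (TV.coreVW kitOf wT j s) s)) := rfl
/-- [folklore] -/ theorem rd_Zlo (j s : ℕ) : (TV.toRadiiW kitOf wT).Zlo j s = TV.base.kerLo (TV.nodeVW kitOf wT j s).Z := rfl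
/-- [folklore] -/ theorem rd_Zhi (j s : ℕ) : (TV.toRadiiW kitOf wT).Zhi j s = TV.base.kerHi (TV.nodeVW kitOf wT j s).Z := rfl
/-- Node `s+1` is the next state of sub-step `s`. [folklore] -/
theorem nodeV_succ (j s : ℕ) : TV.nodeVW kitOf wT j (s + 1) =
    (stepNext TV.base.n TV.prec (kitOf j).precV TV.precB (TV.nodeVW kitOf wT j s) (TV.coreVW kitOf wT j s).M (TV.stageV j).rB
      ((TV.ctxOfW kitOf wT j).nuOf (TV.coreVW kitOf wT j s) s) (TV.nodeE j (s + 1))).1 := rfl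
/-- [folklore] -/ theorem ctx_n (j : ℕ) : (TV.ctxOfW kitOf wT j).n = TV.base.n := rfl

end Rfl

/-! ### Consequences of the Booleans -/

section Facts

/-- Every node passes the frame test. [folklore] -/
theorem nodeOK_nodeV (hC : ChecksOK TV kitOf wT) {j : ℕ} (hj : j ≤ TV.base.N₀) :
    ∀ {s : ℕ}, s ≤ TV.S j → nodeOK TV.base.n TV.prec (TV.nodeVW kitOf wT j s) = true
  | 0, _ => hC.node0 j hj
  | s + 1, hs => (((TV.ctxOfW kitOf wT j).subStep_ok_iff s _).1 (hC.steps j hj s hs)).2.2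

/-- The cross-step tests of sub-step `s` passed. [folklore] -/
theorem stepNext_ok (hC : ChecksOK TV kitOf wT) {j : ℕ} (hj : j ≤ TV.base.N₀) {s : ℕ} (hs : s < TV.S j) :
    (stepNext TV.base.n TV.prec (kitOf j).precV TV.precB (TV.nodeVW kitOf wT j s) (TV.coreVW kitOf wT j s).M (TV.stageV j).rB
      ((TV.ctxOfW kitOf wT j).nuOf (TV.coreVW kitOf wT j s) s) (TV.nodeE j (s + 1))).2 = true :=
  (((TV.ctxOfW kitOf wT j).subStep_ok_iff s _).1 (hC.steps j hj s hs)).2.1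

/-- The retry returns one of the core attempts. [folklore] -/
theorem coreRetry_eq (C : StageCtx) (H2 : Array IntervalD) (h : Dyad) : ∃ L1, C.coreRetry H2 h = C.core H2 h L1 := by
  unfold StageCtx.coreRetry
  by_cases h0 : (C.core H2 h C.L1₀).ok = true
  · exact ⟨C.L1₀, by simp [h0]⟩
  · by_cases h1 : (C.core H2 h (Dyad.shift C.L1₀ 1)).ok = true
    · exact ⟨Dyad.shift C.L1₀ 1, by simp [h0, h1]⟩
    · exact ⟨Dyad.shift C.L1₀ 2, by simp [h0, h1]⟩

/-- The jet bound `J` of the core output is nonnegative (it is a magnitude). [folklore] -/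
theorem coreV_J_nonneg (j s : ℕ) {c : ℕ} (hc : c < TV.base.n) : 0 ≤ vre (TV.coreVW kitOf wT j s).J c := by
  obtain ⟨L1, hL⟩ := coreRetry_eq (TV.ctxOfW kitOf wT j) ((TV.ctxOfW kitOf wT j).hull2 (TV.nodeVW kitOf wT j s) s) (TV.hD j s)
  have e : TV.coreVW kitOf wT j s = (TV.ctxOfW kitOf wT j).core ((TV.ctxOfW kitOf wT j).hull2 (TV.nodeVW kitOf wT j s) s) (TV.hD j s) L1 := hL
  rw [e]
  show 0 ≤ vre (TV.base.coreStep _).J c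
  rw [CoreIn.coreStep_J]
  unfold CoreIn.Jarr vre
  rw [dget_ofFn _ hc]
  exact IntervalD.mag_nonneg _

/-- The centre's window coordinates lie in its point box. [folklore] -/
theorem mem_pointBox_xR (j s : ℕ) {c : ℕ} (hc : c < TV.base.n) :
    IntervalD.mem (TV.base.wv (TV.xR j s) c) (IntervalD.aget ((TV.ctxOfW kitOf wT j).pointBox (TV.xD j s)) c) := by
  unfold StageCtx.pointBox
  rw [ctx_n, IntervalD.aget_ofFn _ hc, TV.wv_xR j s hc]
  exact IntervalD.mem_ofDyad _

end Facts

/-! ### The clauses -/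

section Clauses

/-- (R3) the fresh centre error. [folklore] -/
theorem clause_R3 (hTw : TwinOK (TV := TV) (kitOf := kitOf)) {j : ℕ} {s : ℕ} (i : Fin 4) {k : ℤ}
    (hk1 : -TV.base.Kb ≤ k) (hk2 : k ≤ TV.base.Ka) :
    |(TV.toCertDataVW kitOf wT sc).TP j s (TV.hR j s) i k - TV.xR j (s + 1) i k| +
        (TV.toBoxesW kitOf wT).J j s i k * TV.hR j s ^ (TV.base.pdeg + 1) ≤ (TV.toRadiiW kitOf wT).ν j s i k := by
  have hk : -TV.base.Kb ≤ k ∧ k ≤ TV.base.Ka := ⟨hk1, hk2⟩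
  have hc := TV.base.idx_lt_n i hk
  set C := TV.ctxOfW kitOf wT j with hCdef
  -- the centre polynomial coordinate `c = idx i k` lies in `tph`
  have hTP : ∀ c < TV.base.n, IntervalD.mem
      (∑ m ∈ Finset.range (TV.base.pdeg + 1), TV.base.wv (taylorJet (TV.base.toCertData QS2.toRealHom).Qb (TV.xR j s) m) c *
        (TV.hD j s).toReal ^ m) (IntervalD.aget (C.tph (TV.xD j s) (TV.hD j s)) c) := by
    intro c hc
    unfold StageCtx.tph
    exact IntervalD.mem_polyLevelsA TV.prec
      (fun m hm c' hc' => TV.base.mem_taylorJet_of_jetLevelsA_qBf (hTw j) TV.prec TV.base.pdeg (Y := C.pointBox (TV.xD j s))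
        (by simp only [hCdef, StageCtx.pointBox, Array.size_ofFn]; rfl) (fun c'' hc'' => mem_pointBox_xR j s hc'') m hm c' hc')
      (IntervalD.mem_ofDyad _) c hc
  have hnu := C.nu_sound (TV.coreVW kitOf wT j s) s hTP (fun c hc => coreV_J_nonneg j s hc) hc
  -- translate to window indices
  rw [cd_TP, bx_J, rd_ν, TV.base.vecF_apply, TV.base.vecF_apply, if_pos hk, if_pos hk]
  have e1 : ∑ m ∈ Finset.range (TV.base.pdeg + 1),
      taylorJet (TV.base.toCertData QS2.toRealHom).Qb (TV.xR j s) m i k * TV.hR j s ^ m =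
      ∑ m ∈ Finset.range (TV.base.pdeg + 1),
        TV.base.wv (taylorJet (TV.base.toCertData QS2.toRealHom).Qb (TV.xR j s) m) (TV.base.idx i k) * (TV.hD j s).toReal ^ m :=
    Finset.sum_congr rfl fun m _ => by rw [TV.base.wv_idx _ i hk]; rfl
  have e2 : TV.xR j (s + 1) i k = vre (TV.xD j (s + 1)) (TV.base.idx i k) := by
    rw [← TV.base.wv_idx (TV.xR j (s + 1)) i hk, TV.wv_xR j (s + 1) hc]
  rw [e1, e2]
  exact hnu

/-- HINGE: a level-1 node pair lies in the level-1 hull. [folklore] -/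
theorem clause_hinge {j s : ℕ} {ζ y₀ y : Fin 4 → ℤ → ℝ}
    (hN : NodePair (TV.toCertDataVW kitOf wT sc) (TV.toBoxesW kitOf wT) (TV.toRadiiW kitOf wT) j s ζ y₀ y) :
    InBox (TV.toCertDataVW kitOf wT sc) ((TV.toBoxesW kitOf wT).hlo 1 j s) ((TV.toBoxesW kitOf wT).hhi 1 j s) y := by
  obtain ⟨⟨ξ, hξ, hy₀⟩, hζ, hd⟩ := hN
  set N := TV.nodeVW kitOf wT j s
  set C := TV.ctxOfW kitOf wT j
  rw [bx_rPl] at hξ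
  rw [rd_rB] at hζ
  rw [rd_e, rd_Vc] at hd
  rw [cd_x, cd_Cm] at hy₀
  rw [bx_hlo1, bx_hhi1, TV.base.inBox_vecF_iff cd_Kb cd_Ka]
  intro c hc
  have hξ' := TV.base.absLeVec_of_absLeW cd_Kb cd_Ka hξ
  have hζ' := TV.base.absLeVec_of_absLeW cd_Kb cd_Ka hζ
  have hd' := TV.base.absLeVec_of_absLeW cd_Kb cd_Ka hd c hc
  -- `wv y c = wv x c + wv (B ξ) c + wv (Vc ζ) c + wv d c`
  have ey : TV.base.wv y c = vre (TV.xD j s) c + TV.base.wv (TV.base.linF (dre N.B) ξ) c +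
      TV.base.wv (TV.base.linF (dre N.Vc) ζ) c + TV.base.wv (y - y₀ - TV.base.linF (dre N.Vc) ζ) c := by
    simp only [CertTables.wv, Pi.sub_apply, hy₀, Pi.add_apply]
    rw [← TV.wv_xR j s hc]
    simp only [CertTables.wv]
    ring
  have h1 : |TV.base.wv (TV.base.linF (dre N.B) ξ) c| ≤ vre (absMulVecUp TV.base.n TV.prec (absD TV.base.n N.B) N.rp) c := by
    rw [TV.base.wv_linF _ _ hc]; exact abs_sum_le_absMulVecUp TV.prec (absLeMat_absD N.B) hξ' hc
  have h2 : |TV.base.wv (TV.base.linF (dre N.Vc) ζ) c| ≤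
      vre (absMulVecUp TV.base.n TV.prec (absD TV.base.n N.Vc) (TV.stageV j).rB) c := by
    rw [TV.base.wv_linF _ _ hc]; exact abs_sum_le_absMulVecUp TV.prec (absLeMat_absD N.Vc) hζ' hc
  have hsum : |TV.base.wv y c - vre (TV.xD j s) c| ≤ vre (C.hullRad N) c := by
    have hr1 := add_le_addVecUp TV.prec (absMulVecUp TV.base.n TV.prec (absD TV.base.n N.Vc) (TV.stageV j).rB) N.e hc
    have hr2 := add_le_addVecUp TV.prec
      (addVecUp TV.base.n TV.prec (absMulVecUp TV.base.n TV.prec (absD TV.base.n N.Vc) (TV.stageV j).rB) N.e)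
      (absMulVecUp TV.base.n TV.prec (absD TV.base.n N.B) N.rp) hc
    rw [ey]
    have e : vre (TV.xD j s) c + TV.base.wv (TV.base.linF (dre N.B) ξ) c + TV.base.wv (TV.base.linF (dre N.Vc) ζ) c +
        TV.base.wv (y - y₀ - TV.base.linF (dre N.Vc) ζ) c - vre (TV.xD j s) c =
        TV.base.wv (TV.base.linF (dre N.Vc) ζ) c + TV.base.wv (y - y₀ - TV.base.linF (dre N.Vc) ζ) c +
        TV.base.wv (TV.base.linF (dre N.B) ξ) c := by ring
    rw [e]
    refine le_trans (abs_add_le _ _) ?_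
    refine le_trans (add_le_add ((abs_add_le _ _).trans (add_le_add h2 hd')) h1) ?_
    exact le_trans (add_le_add hr1 le_rfl) hr2
  have h' := abs_le.1 hsum
  exact ⟨by unfold loOf; linarith [h'.1], by unfold hiOf; linarith [h'.2]⟩

/-- (R2) centre radii absorption. [folklore] -/
theorem clause_R2 (hC : ChecksOK TV kitOf wT) {j : ℕ} (hj : j ≤ TV.base.N₀) {s : ℕ} (hs : s < TV.S j) {A : Ker}
    (hA : KerMem (TV.toCertDataVW kitOf wT sc) A ((TV.toBoxesW kitOf wT).Mlo j s) ((TV.toBoxesW kitOf wT).Mhi j s))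
    {ξ r : Fin 4 → ℤ → ℝ} (hξ : AbsLeW (TV.toCertDataVW kitOf wT sc) ξ ((TV.toBoxesW kitOf wT).rPl 0 j s))
    (hr : AbsLeW (TV.toCertDataVW kitOf wT sc) r ((TV.toRadiiW kitOf wT).ν j s)) :
    AbsLeW (TV.toCertDataVW kitOf wT sc)
      ((TV.toCertDataVW kitOf wT sc).Ci j (s + 1) (kapp (TV.toCertDataVW kitOf wT sc) A ((TV.toCertDataVW kitOf wT sc).Cm j s ξ) + r))
      ((TV.toBoxesW kitOf wT).rPl 0 j (s + 1)) := by
  set N := TV.nodeVW kitOf wT j s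
  set N' := TV.nodeVW kitOf wT j (s + 1) with hN'
  have hg := (invMat_spec_of_nodeOK TV.prec (nodeOK_nodeV hC hj (Nat.succ_le_of_lt hs))).2.2
  rw [bx_Mlo, bx_Mhi] at hA
  have ha := TV.base.memMat_matOfKer cd_Kb cd_Ka hA
  rw [bx_rPl] at hξ ⊢
  rw [rd_ν] at hr
  have hξ' := TV.base.absLeVec_of_absLeW cd_Kb cd_Ka hξ
  have hr' := TV.base.absLeVec_of_absLeW cd_Kb cd_Ka hr
  have hS := (stepNext_sound TV.prec (stepNext_ok hC hj hs) (by rw [← nodeV_succ]; exact hg) ha).1 hξ' hr'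
  rw [cd_Ci, cd_Cm, TV.base.kapp_eq_linF cd_Kb cd_Ka]
  refine TV.base.absLeW_vecF_of_absLeVec cd_Kb cd_Ka fun c hc => ?_
  rw [TV.base.wv_linF _ _ hc]
  have e : ∑ t ∈ Finset.range TV.base.n, invMat TV.base.n N'.B c t *
      TV.base.wv (TV.base.linF (TV.base.matOfKer A) (TV.base.linF (dre N.B) ξ) + r) t =
      ∑ t ∈ Finset.range TV.base.n, invMat TV.base.n N'.B c t *
        (∑ u ∈ Finset.range TV.base.n, TV.base.matOfKer A t u *
          ∑ v ∈ Finset.range TV.base.n, dre N.B u v * TV.base.wv ξ v + TV.base.wv r t) := by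
    refine Finset.sum_congr rfl fun t ht => ?_
    have ht' := Finset.mem_range.1 ht
    congr 1
    show TV.base.wv (TV.base.linF (TV.base.matOfKer A) (TV.base.linF (dre N.B) ξ)) t + TV.base.wv r t = _
    rw [TV.base.wv_linF _ _ ht']
    congr 1
    exact Finset.sum_congr rfl fun u hu => by rw [TV.base.wv_linF _ _ (Finset.mem_range.1 hu)]
  rw [e, nodeV_succ]
  exact hS c hc

/-- (R4) plain set-error update. [folklore] -/
theorem clause_R4 (hC : ChecksOK TV kitOf wT) {j : ℕ} (hj : j ≤ TV.base.N₀) {s : ℕ} (hs : s < TV.S j) {A : Ker}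
    (hA : KerMem (TV.toCertDataVW kitOf wT sc) A ((TV.toBoxesW kitOf wT).Mlo j s) ((TV.toBoxesW kitOf wT).Mhi j s))
    {ζ d : Fin 4 → ℤ → ℝ} (hζ : AbsLeW (TV.toCertDataVW kitOf wT sc) ζ ((TV.toRadiiW kitOf wT).rB j))
    (hd : AbsLeW (TV.toCertDataVW kitOf wT sc) d ((TV.toRadiiW kitOf wT).e j s)) :
    AbsLeW (TV.toCertDataVW kitOf wT sc)
      (kapp (TV.toCertDataVW kitOf wT sc) A ((TV.toRadiiW kitOf wT).Vc j s ζ + d) - (TV.toRadiiW kitOf wT).Vc j (s + 1) ζ)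
      ((TV.toRadiiW kitOf wT).e j (s + 1)) := by
  set N := TV.nodeVW kitOf wT j s
  have hg := (invMat_spec_of_nodeOK TV.prec (nodeOK_nodeV hC hj (Nat.succ_le_of_lt hs))).2.2
  rw [bx_Mlo, bx_Mhi] at hA
  have ha := TV.base.memMat_matOfKer cd_Kb cd_Ka hA
  rw [rd_rB] at hζ
  rw [rd_e] at hd ⊢
  have hζ' := TV.base.absLeVec_of_absLeW cd_Kb cd_Ka hζ
  have hd' := TV.base.absLeVec_of_absLeW cd_Kb cd_Ka hd
  have hS := (stepNext_sound TV.prec (stepNext_ok hC hj hs) (by rw [← nodeV_succ]; exact hg) ha).2.1 hζ' hd'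
  rw [rd_Vc, rd_Vc, TV.base.kapp_eq_linF cd_Kb cd_Ka]
  refine TV.base.absLeW_vecF_of_absLeVec cd_Kb cd_Ka fun c hc => ?_
  have e : TV.base.wv (TV.base.linF (TV.base.matOfKer A) (TV.base.linF (dre N.Vc) ζ + d) -
      TV.base.linF (dre (TV.nodeVW kitOf wT j (s + 1)).Vc) ζ) c =
      ∑ u ∈ Finset.range TV.base.n, TV.base.matOfKer A c u *
          (∑ v ∈ Finset.range TV.base.n, dre N.Vc u v * TV.base.wv ζ v + TV.base.wv d u) -
        ∑ v ∈ Finset.range TV.base.n, dre (TV.nodeVW kitOf wT j (s + 1)).Vc c v * TV.base.wv ζ v := by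
    show TV.base.wv (TV.base.linF (TV.base.matOfKer A) (TV.base.linF (dre N.Vc) ζ + d)) c -
      TV.base.wv (TV.base.linF (dre (TV.nodeVW kitOf wT j (s + 1)).Vc) ζ) c = _
    rw [TV.base.wv_linF _ _ hc, TV.base.wv_linF _ _ hc]
    congr 1
    refine Finset.sum_congr rfl fun u hu => ?_
    congr 1
    show TV.base.wv (TV.base.linF (dre N.Vc) ζ) u + TV.base.wv d u = _
    rw [TV.base.wv_linF _ _ (Finset.mem_range.1 hu)]
  rw [e, nodeV_succ]
  exact hS c hc

/-- (R5) derivative-error transport. [folklore] -/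
theorem clause_R5 (hC : ChecksOK TV kitOf wT) {j : ℕ} (hj : j ≤ TV.base.N₀) {s : ℕ} (hs : s < TV.S j) {A : Ker}
    (hA : KerMem (TV.toCertDataVW kitOf wT sc) A ((TV.toBoxesW kitOf wT).Mlo j s) ((TV.toBoxesW kitOf wT).Mhi j s)) {W : Ker}
    (hW : KerMem (TV.toCertDataVW kitOf wT sc) W ((TV.toRadiiW kitOf wT).Zlo j s) ((TV.toRadiiW kitOf wT).Zhi j s)) :
    ∃ W' : Ker, KerMem (TV.toCertDataVW kitOf wT sc) W' ((TV.toRadiiW kitOf wT).Zlo j (s + 1)) ((TV.toRadiiW kitOf wT).Zhi j (s + 1)) ∧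
      ∀ v, (TV.toCertDataVW kitOf wT sc).Wsupp v →
        kapp (TV.toCertDataVW kitOf wT sc) A ((TV.toRadiiW kitOf wT).Vc j s v + (TV.toCertDataVW kitOf wT sc).Cm j s (kapp (TV.toCertDataVW kitOf wT sc) W v)) =
          (TV.toRadiiW kitOf wT).Vc j (s + 1) v + (TV.toCertDataVW kitOf wT sc).Cm j (s + 1) (kapp (TV.toCertDataVW kitOf wT sc) W' v) := by
  have hinv := invMat_spec_of_nodeOK TV.prec (nodeOK_nodeV hC hj (Nat.succ_le_of_lt hs))
  rw [bx_Mlo, bx_Mhi] at hA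
  rw [rd_Zlo, rd_Zhi] at hW
  have ha := TV.base.memMat_matOfKer cd_Kb cd_Ka hA
  have hw := TV.base.memMat_matOfKer cd_Kb cd_Ka hW
  have hS := (stepNext_sound TV.prec (stepNext_ok hC hj hs) (by rw [← nodeV_succ]; exact hinv.2.2) ha).2.2 hw
  rw [← nodeV_succ] at hS
  -- the transported kernel, in coordinates
  set w' : ℕ → ℕ → ℝ := fun i c =>
    mulF TV.base.n (invMat TV.base.n (TV.nodeVW kitOf wT j (s + 1)).B)
        (fun t c => mulF TV.base.n (TV.base.matOfKer A) (dre (TV.nodeVW kitOf wT j s).Vc) t c - dre (TV.nodeVW kitOf wT j (s + 1)).Vc t c) i c +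
      mulF TV.base.n (mulF TV.base.n (invMat TV.base.n (TV.nodeVW kitOf wT j (s + 1)).B)
        (mulF TV.base.n (TV.base.matOfKer A) (dre (TV.nodeVW kitOf wT j s).B))) (TV.base.matOfKer W) i c with hw'
  have hw'Z : MemMat TV.base.n w' (TV.nodeVW kitOf wT j (s + 1)).Z := hS
  refine ⟨TV.base.kerOfMat w', ?_, fun v _ => ?_⟩
  · rw [rd_Zlo, rd_Zhi]; exact TV.base.kerMem_kerOfMat cd_Kb cd_Ka hw'Z
  -- the identity `A·(Vc v + B·(W v)) = Vc' v + B'·(W' v)`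
  rw [rd_Vc, rd_Vc, cd_Cm, cd_Cm, TV.base.kapp_eq_linF cd_Kb cd_Ka, TV.base.kapp_eq_linF cd_Kb cd_Ka,
    TV.base.kapp_eq_linF cd_Kb cd_Ka]
  rw [TV.base.linF_congr (a := TV.base.matOfKer (TV.base.kerOfMat w')) (b := w')
    (fun r hr c hc => TV.base.matOfKer_kerOfMat w' hr hc)]
  rw [TV.base.linF_add, TV.base.linF_linF_mulF, TV.base.linF_linF_mulF, TV.base.linF_linF_mulF, TV.base.linF_linF_mulF,
    hw']
  have hid := hinv.1
  -- abstract the coordinate matrices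
  generalize invMat TV.base.n (TV.nodeVW kitOf wT j (s + 1)).B = g at hid ⊢
  generalize TV.base.matOfKer A = a
  generalize TV.base.matOfKer W = w
  generalize dre (TV.nodeVW kitOf wT j s).B = b
  generalize dre (TV.nodeVW kitOf wT j s).Vc = vc
  generalize dre (TV.nodeVW kitOf wT j (s + 1)).Vc = vc'
  generalize dre (TV.nodeVW kitOf wT j (s + 1)).B = b' at hid ⊢
  -- `b'·w' = (a·vc − vc') + (a·b)·w` on the block rows
  have key : ∀ r < TV.base.n, ∀ c < TV.base.n,
      mulF TV.base.n b' (fun i c => mulF TV.base.n g (fun t c => mulF TV.base.n a vc t c - vc' t c) i c +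
          mulF TV.base.n (mulF TV.base.n g (mulF TV.base.n a b)) w i c) r c =
        (mulF TV.base.n a vc r c - vc' r c) + mulF TV.base.n (mulF TV.base.n a b) w r c := by
    have hid' : ∀ r < TV.base.n, ∀ c < TV.base.n, mulF TV.base.n b' g r c = if r = c then 1 else 0 :=
      fun r hr c hc => hid r hr c hc
    intro r hr c _
    rw [mulF_add]
    simp only
    rw [← mulF_assoc _ b' g, mulF_id_left _ hid' _ hr, mulF_assoc _ g (mulF _ a b) w, ← mulF_assoc _ b' g,
      mulF_id_left _ hid' _ hr]
  rw [TV.base.linF_congr key, TV.base.linF_matAdd, TV.base.linF_matSub]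
  abel

/-- **The radii side of the v3 chain predicate from the Booleans.** [folklore] -/
theorem chainVRadii_of_checks (hC : ChecksOK TV kitOf wT) (hE : EntryOK TV kitOf wT sc) (hTw : TwinOK (TV := TV) (kitOf := kitOf)) :
    ChainVRadii (TV.toCertDataVW kitOf wT sc) (TV.toBoxesW kitOf wT) (TV.toRadiiW kitOf wT) := by
  intro j hj
  rw [cd_N₀] at hj
  refine ⟨TV.base.isLinearMap_linF _, fun v i k hk => TV.base.linF_off _ v i hk, fun i k => ?_, hE j hj, fun v => rfl, ?_, ?_, ?_⟩
  · -- `rB ≥ 0`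
    rw [rd_rB, TV.base.vecF_apply]
    split_ifs with hk
    · exact nonneg_of_nonnegVec (hC.rB j hj) (TV.base.idx_lt_n i hk)
    · exact le_rfl
  · -- `0 ∈ [Z 0]`
    intro i' k' hk1' hk2' i k hk1 hk2
    have hk' : -TV.base.Kb ≤ k' ∧ k' ≤ TV.base.Ka := ⟨hk1', hk2'⟩
    have hk : -TV.base.Kb ≤ k ∧ k ≤ TV.base.Ka := ⟨hk1, hk2⟩
    rw [rd_Zlo, rd_Zhi]
    show (imget (TV.nodeVW kitOf wT j 0).Z (TV.base.idx i' k') (TV.base.idx i k)).lo.toReal ≤ 0 ∧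
      0 ≤ (imget (TV.nodeVW kitOf wT j 0).Z (TV.base.idx i' k') (TV.base.idx i k)).hi.toReal
    have e : imget (TV.nodeVW kitOf wT j 0).Z (TV.base.idx i' k') (TV.base.idx i k) = IntervalD.ofInt 0 := by
      show imget (zeroIM TV.base.n) _ _ = _
      simp only [zeroIM, imget_ofFn_row _ _ (TV.base.idx_lt_n i' hk'), IntervalD.aget_ofFn _ (TV.base.idx_lt_n i hk)]
    rw [e]
    exact ⟨(IntervalD.mem_ofInt 0).1.trans (le_of_eq (by simp)), (le_of_eq (by simp)).trans (IntervalD.mem_ofInt 0).2⟩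
  · -- node clauses
    intro s hs
    rw [cd_S] at hs
    refine ⟨TV.base.isLinearMap_linF _, fun v i k hk => TV.base.linF_off _ v i hk, fun i k => ?_, fun ζ y₀ y hN => clause_hinge hN⟩
    rw [rd_e, TV.base.vecF_apply]
    split_ifs with hk
    · exact (exists_inv_of_nodeOK TV.prec (nodeOK_nodeV hC hj hs)).2.1 _ (TV.base.idx_lt_n i hk)
    · exact le_rfl
  · -- sub-step clauses
    intro s hs
    rw [cd_S] at hs
    refine ⟨fun i k hk1 hk2 => ?_, fun A hA ξ r hξ hr => clause_R2 hC hj hs hA hξ hr,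
      fun A hA ζ d hζ hd => clause_R4 hC hj hs hA hζ hd, fun A hA W hW => clause_R5 hC hj hs hA hW⟩
    rw [cd_h, cd_x, cd_pdeg]
    exact clause_R3 hTw i hk1 hk2

end Clauses

end CertTablesV

end Summit.NavierStokesRegularity.NavierStokesRegularity.Theorems.TaylorModelCert
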